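import Literature.NumberTheory.EllipticCurves.IwasawaTwistModPShapiroConj
import Literature.NumberTheory.EllipticCurves.IwasawaTwistModPNormIdentity
import Literature.NumberTheory.GaloisRepresentations.ContinuousCorestrictionResNorm
import HarnessLib

/-!
# Shapiro for the Iwasawa twists, IV: the dictionary **`res_{K_n → K_m} ↔ T^{p^m − p^n}`** — restriction
# in the `ℤ_p`-tower becomes the `T^{p^m−p^n}`-embedding `𝒯_{p^n} ↪ 𝒯_{p^m}` under `Sh⁻¹`

Topic `NumberTheory/EllipticCurves` (sequel of `IwasawaTwistModPShapiroCores` / `…Conj`); namespace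
`Literature.NumberTheory.EllipticCurves.ZpExtension`.  Cell `bsd-smallim` (rung K6 of
`BirchSwinnertonDyer`, crux `MuTransferX9` = item 19276, open stub `stub_coreX9`), seat
`bsd-smallim-k6-ty` (typer), CORE-PLAN S2.1, last dictionary entry: for `n ≤ m` and
`y ∈ H¹(Γ_n, M) = H¹(K_n, M)`,
`coresShapiro m (res_{Γ_m}^{Γ_n} y) = H¹(T^{p^m − p^n}·) (coresShapiro n y)` in `H¹(K, 𝒯_{p^m})`,
where `T^{p^m−p^n}· : 𝒯_{p^n} ↪ 𝒯_{p^m}` is `twistModPShiftEmbed` — so the direct system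
`(H¹(K_n, M), res)` (whose colimit is `H¹(K_∞, M)`) is the direct system `(H¹(K, 𝒯_{p^n}), T^{p^m−p^n})`
(whose colimit is `H¹(K, M ⊗ Λ^∨(χ)) = H¹(K, 𝒯^∨)`).  PROOFS (and no definition of substance); no fact.

Ingredients: `cores_m = cores_n ∘ cor_{Γ_n/Γ_m}` (`cores_coresLe_eq_cores`), the projection formula
`cor_{Γ_n/Γ_m} ∘ H¹(ι_m) ∘ res = H¹(N ι_m)` (`coresLe_cohomologyMap_resLe`), the computation
**`N ι_m = T^{p^m−p^n} ∘ ι_n`** (`sum_normConj_unitCoeffHom`: `Σ_{σ ∈ Γ_n/Γ_m} σ·(σ⁻¹m)T⁰ =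
Σ_{j<p^{m−n}} (1+S)^{j p^n} (m T⁰) = S^{p^m−p^n}(m T⁰)`, by `sum_unipotentPow_mul_prime_pow` and the
enumeration `sum_layerQuotient_eq` of `Γ_n/Γ_m` by `κ̄_m/p^n`), and `cores ∘ H¹(T^{p^m−p^n}) =
H¹(T^{p^m−p^n}) ∘ cores` (`cohomologyMap_cores`).

## References

* J.-P. Serre, *Galois Cohomology* (1997), I §2.5 (induced modules and their functoriality in `H`).
  [SerreGaloisCohomology1997]
* J. Neukirch, A. Schmidt, K. Wingberg, *Cohomology of Number Fields* (2008), I §5 Prop. 1.5.3 (iv),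
  (1.5.4); (1.6.5). [NeukirchSchmidtWingberg2008]
* L. Washington, *Introduction to Cyclotomic Fields* (1997), §13.1–§13.2 (`ν_{n,m}`). [Washington1997]
-/

noncomputable section

open scoped Topology ContRepresentation
open Field Filter CategoryTheory Finset

universe u

namespace Literature.NumberTheory.EllipticCurves

open Literature.NumberTheory.GaloisRepresentations

namespace ZpExtension

variable {K : Type u} [Field K] {p : ℕ} [Fact p.Prime] (κ : ZpExtension K p)
variable {M : Type u} [AddCommGroup M] [TopologicalSpace M] [DiscreteTopology M]
variable (ρ : DiscreteGaloisModule K M) (hM : ∀ x : M, p • x = 0)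

/-- `toT(δ_c · v) = (1+S)^{c} (v T⁰)`. [cite: Washington1997, §13.1–§13.2] -/
theorem twistGroupRingToModP_single {M : Type u} [AddCommGroup M] {p : ℕ} [Fact p.Prime] (n : ℕ)
    (c : ZMod (p ^ n)) (v : M) :
    twistGroupRingToModP (p := p) n (Pi.single c v) =
      unipotentPow M (p ^ n) c.val (unitCoeff n v) := by
  funext i
  rw [twistGroupRingToModP_single_apply, unitCoeff_apply, unipotentPow_single_zero_apply]

/-- `T^{p^m − p^n} · (v T⁰)` computed in two ways: the `T^{p^m−p^n}`-embedding of `v T⁰ ∈ 𝒯_{p^n}` is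
`S^{p^m − p^n} (v T⁰)` in `𝒯_{p^m}`. [cite: Washington1997, §13.1–§13.2] -/
theorem shiftEmbed_unitCoeff {M : Type u} [AddCommGroup M] {p : ℕ} [Fact p.Prime] {n m : ℕ}
    (hle : p ^ n ≤ p ^ m) (v : M) :
    shiftEmbed (p ^ m) hle (unitCoeff n v) =
      (shiftEnd M (p ^ m) ^ (p ^ m - p ^ n)) (unitCoeff m v) := by
  funext i
  rw [shiftEmbed_apply, shiftEnd_pow_apply, unitCoeff_apply, unitCoeff_apply]
  by_cases h : p ^ m - p ^ n ≤ (i : ℕ)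
  · rw [dif_pos h, dif_neg (not_lt.2 h)]
    simp only [Pi.single_apply, Fin.ext_iff]
  · rw [dif_neg h, dif_pos (not_le.1 h)]


/-! ## `κ̄_n = κ̄_m mod p^n` and the enumeration of `Γ_n/Γ_m` by `κ̄_m / p^n` -/

section LayerIndex

/-- `κ̄_n(g) = κ̄_m(g) mod p^n` for `n ≤ m`. [cite: Washington1997, §13.1–§13.2] -/
theorem cast_layerIndex {n m : ℕ} (hnm : n ≤ m) (g : absoluteGaloisGroup K) :
    (ZMod.cast (κ.layerIndex m g) : ZMod (p ^ n)) = κ.layerIndex n g := by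
  rw [layerIndex, layerIndex, PadicInt.cast_toZModPow n m hnm]

/-- For `g ∈ Γ_n` and `n ≤ m`, `p^n ∣ κ̄_m(g)` (as a natural number `< p^m`).
[cite: Washington1997, §13.1–§13.2] -/
theorem pow_dvd_layerIndex_val {n m : ℕ} (hnm : n ≤ m) {g : absoluteGaloisGroup K}
    (hg : g ∈ κ.layerSubgroup n) : p ^ n ∣ (κ.layerIndex m g).val := by
  haveI : NeZero (p ^ m) := ⟨(pow_pos (Fact.out : p.Prime).pos m).ne'⟩
  have h := κ.cast_layerIndex hnm g
  rw [ZMod.cast_eq_val, (κ.layerIndex_eq_zero_iff n g).2 hg] at h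
  exact (ZMod.natCast_eq_zero_iff _ _).1 h

/-- `κ̄_m(g) = 0 ↔ κ̄_m(a) = κ̄_m(b)` bookkeeping: `κ̄_m(a⁻¹ b) = 0 ↔ κ̄_m a = κ̄_m b`. [folklore] -/
private theorem layerIndex_inv_mul_eq_zero_iff (m : ℕ) (a b : absoluteGaloisGroup K) :
    κ.layerIndex m (a⁻¹ * b) = 0 ↔ κ.layerIndex m a = κ.layerIndex m b := by
  rw [layerIndex_mul, layerIndex_inv, neg_add_eq_zero]

/-- **Enumeration of `Γ_n / Γ_m` by `κ̄_m / p^n`**: for a system of representatives `s` of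
`Γ_n ⧸ Γ_m` (`n ≤ m`) and any `F`, `Σ_x F(κ̄_m(s x)) = Σ_{j < p^{m−n}} F(j p^n)` — `κ̄_m` induces
`Γ_n/Γ_m ≅ p^nℤ/p^mℤ`. [cite: Washington1997, §13.1–§13.2] -/
theorem sum_layerQuotient_eq {A : Type*} [AddCommMonoid A] {n m : ℕ} (hnm : n ≤ m)
    [Fintype (κ.layerSubgroup n ⧸ (κ.layerSubgroup m).subgroupOf (κ.layerSubgroup n))]
    {s : κ.layerSubgroup n ⧸ (κ.layerSubgroup m).subgroupOf (κ.layerSubgroup n) → κ.layerSubgroup n}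
    (hs : ∀ x, (s x : κ.layerSubgroup n ⧸ (κ.layerSubgroup m).subgroupOf (κ.layerSubgroup n)) = x)
    (F : ℕ → A) :
    ∑ x, F (κ.layerIndex m (s x : absoluteGaloisGroup K)).val =
      ∑ j ∈ range (p ^ (m - n)), F (j * p ^ n) := by
  classical
  have hp : p.Prime := Fact.out
  haveI : NeZero (p ^ m) := ⟨(pow_pos hp.pos m).ne'⟩
  have hpn : 0 < p ^ n := pow_pos hp.pos n
  have hpm : p ^ (m - n) * p ^ n = p ^ m := by rw [← pow_add, Nat.sub_add_cancel hnm]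
  have hval : ∀ x, (κ.layerIndex m (s x : absoluteGaloisGroup K)).val =
      (κ.layerIndex m (s x : absoluteGaloisGroup K)).val / p ^ n * p ^ n :=
    fun x ↦ (Nat.div_mul_cancel (κ.pow_dvd_layerIndex_val hnm (s x).2)).symm
  -- same class in `Γ_n/Γ_m` ↔ same `κ̄_m`
  have hclass : ∀ a b : κ.layerSubgroup n,
      (a : κ.layerSubgroup n ⧸ (κ.layerSubgroup m).subgroupOf (κ.layerSubgroup n)) = b ↔
        κ.layerIndex m (a : absoluteGaloisGroup K) = κ.layerIndex m (b : absoluteGaloisGroup K) := by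
    intro a b
    rw [QuotientGroup.eq, Subgroup.mem_subgroupOf, Subgroup.coe_mul, Subgroup.coe_inv,
      ← layerIndex_eq_zero_iff, layerIndex_inv_mul_eq_zero_iff]
  refine Finset.sum_nbij (fun x ↦ (κ.layerIndex m (s x : absoluteGaloisGroup K)).val / p ^ n)
    ?_ ?_ ?_ ?_
  · intro x _
    rw [Finset.mem_range, Nat.div_lt_iff_lt_mul hpn, hpm]
    exact ZMod.val_lt _
  · intro x _ y _ hxy
    have h : (κ.layerIndex m (s x : absoluteGaloisGroup K)).val =
        (κ.layerIndex m (s y : absoluteGaloisGroup K)).val := by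
      rw [hval x, hval y]
      exact congrArg (· * p ^ n) hxy
    rw [← hs x, ← hs y, hclass]
    exact ZMod.val_injective _ h
  · intro j hj
    rw [Finset.coe_range, Set.mem_Iio] at hj
    obtain ⟨g, hg⟩ := κ.layerIndex_surjective m ((j * p ^ n : ℕ) : ZMod (p ^ m))
    have hgn : g ∈ κ.layerSubgroup n := by
      rw [← layerIndex_eq_zero_iff, ← κ.cast_layerIndex hnm, hg, ZMod.cast_natCast (pow_dvd_pow p hnm),
        ZMod.natCast_eq_zero_iff]
      exact dvd_mul_left _ _
    refine ⟨((⟨g, hgn⟩ : κ.layerSubgroup n) : κ.layerSubgroup n ⧸ _), Finset.mem_coe.2 (mem_univ _), ?_⟩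
    have hsx : κ.layerIndex m (s ((⟨g, hgn⟩ : κ.layerSubgroup n) : κ.layerSubgroup n ⧸ _) :
        absoluteGaloisGroup K) = κ.layerIndex m g := (hclass _ ⟨g, hgn⟩).1 (hs _)
    change (κ.layerIndex m _).val / p ^ n = j
    rw [hsx, hg, ZMod.val_natCast, Nat.mod_eq_of_lt (by rw [← hpm]; exact Nat.mul_lt_mul_of_pos_right hj hpn),
      Nat.mul_div_cancel _ hpn]
  · intro x _
    exact congrArg F (hval x)

end LayerIndex

/-! ## `N ι_m = T^{p^m − p^n} ∘ ι_n` -/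

section Norm

variable {n m : ℕ} (hnm : n ≤ m)
  [Fintype (κ.layerSubgroup n ⧸ (κ.layerSubgroup m).subgroupOf (κ.layerSubgroup n))]
  {s : κ.layerSubgroup n ⧸ (κ.layerSubgroup m).subgroupOf (κ.layerSubgroup n) → κ.layerSubgroup n}

/-- **The norm of `ι_m : m ↦ m·T⁰` from `Γ_m` to `Γ_n` is `T^{p^m − p^n} ∘ ι_n`**: for `v ∈ M`,
`Σ_{σ ∈ Γ_n/Γ_m} σ · ((σ⁻¹ v) T⁰) = Σ_σ (1+S)^{κ̄_m(σ)} (v T⁰) = Σ_{j<p^{m−n}} (1+S)^{j p^n} (v T⁰) =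
S^{p^m − p^n} (v T⁰) = T^{p^m−p^n} · ι_n(v)` (`sum_layerQuotient_eq`, `sum_unipotentPow_mul_prime_pow`).
[cite: Washington1997, §13.1–§13.2] [cite: NeukirchSchmidtWingberg2008, I §5 (1.5.4)] -/
theorem sum_normConj_unitCoeffHom
    (hs : ∀ x, (s x : κ.layerSubgroup n ⧸ (κ.layerSubgroup m).subgroupOf (κ.layerSubgroup n)) = x)
    (v : M) :
    ∑ x, normConj (κ.unitCoeffHom ρ hM m) ((s x : κ.layerSubgroup n) : absoluteGaloisGroup K) v =
      shiftEmbed (p ^ m) (Nat.pow_le_pow_right (Fact.out : p.Prime).pos hnm) (unitCoeff n v) := by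
  have h1 : ∀ x, normConj (κ.unitCoeffHom ρ hM m) ((s x : κ.layerSubgroup n) : absoluteGaloisGroup K) v =
      unipotentPow M (p ^ m) (κ.layerIndex m ((s x : κ.layerSubgroup n) : absoluteGaloisGroup K)).val
        (unitCoeff m v) := fun x ↦ by
    rw [normConj_apply, unitCoeffHom_hom_apply, ContinuousRep.toTopRep_ρ_apply,
      ContinuousRep.toTopRep_ρ_apply, twistModP_unitCoeff, ← Module.End.mul_apply, ← map_mul,
      mul_inv_cancel, map_one, Module.End.one_apply, twistGroupRingToModP_single]
  simp_rw [h1]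
  rw [κ.sum_layerQuotient_eq hnm hs (fun a ↦ unipotentPow M (p ^ m) a (unitCoeff m v)),
    ← LinearMap.sum_apply, sum_unipotentPow_mul_prime_pow hM (p ^ m) n (m - n),
    Nat.add_sub_cancel' hnm, shiftEmbed_unitCoeff]

end Norm

/-! ## `res ↔ T^{p^m − p^n}` under `Sh⁻¹` -/

section Res

/-- **The dictionary `res_{K_n → K_m} ↔ T^{p^m−p^n}`.**  For `n ≤ m` and `c ∈ H¹(Γ_n, M) = H¹(K_n, M)`:
`coresShapiro m (res_{Γ_m}^{Γ_n} c) = H¹(T^{p^m−p^n}·) (coresShapiro n c)` in `H¹(K, 𝒯_{p^m})`, where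
`coresShapiro = Sh⁻¹` (`coresShapiro_eq_symm`) and `T^{p^m−p^n}· = twistModPShiftEmbed : 𝒯_{p^n} ↪ 𝒯_{p^m}`.
Proof: `cores_m = cores_n ∘ cor_{Γ_n/Γ_m}`, the projection formula `cor ∘ H¹(ι_m) ∘ res = H¹(N ι_m)`,
`N ι_m = T^{p^m−p^n} ∘ ι_n`, and `cores ∘ H¹(T^{p^m−p^n}) = H¹(T^{p^m−p^n}) ∘ cores`.  (Serre: the
functoriality of `A ↦ M_G^H(A)` in `H`; the transition maps of `lim→_n H¹(K_n, M) = H¹(K_∞, M) =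
H¹(K, lim→ 𝒯_{p^n})`.)  All finiteness structures are instance binders.
[cite: SerreGaloisCohomology1997, I §2.5] [cite: NeukirchSchmidtWingberg2008, I §5 Prop. 1.5.3 (iv)] -/
theorem coresShapiro_resLe {n m : ℕ} (hnm : n ≤ m)
    [Fintype (absoluteGaloisGroup K ⧸ κ.layerSubgroup n)]
    [Fintype (absoluteGaloisGroup K ⧸ κ.layerSubgroup m)]
    [Fintype (κ.layerSubgroup n ⧸ (κ.layerSubgroup m).subgroupOf (κ.layerSubgroup n))]
    (c : continuousCohomology 1 (subgroupRep ρ.toTopRep (κ.layerSubgroup n))) :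
    κ.coresShapiro ρ hM m (resLe ρ.toTopRep (κ.layerSubgroup_antitone hnm) 1 c) =
      galoisCohomology.map
        (κ.twistModPShiftEmbed ρ hM (p ^ m) (Nat.pow_le_pow_right (Fact.out : p.Prime).pos hnm)) 1
        (κ.coresShapiro ρ hM n c) := by
  classical
  have hs : ∀ x : κ.layerSubgroup n ⧸ (κ.layerSubgroup m).subgroupOf (κ.layerSubgroup n),
      ((Quotient.out x : κ.layerSubgroup n) :
        κ.layerSubgroup n ⧸ (κ.layerSubgroup m).subgroupOf (κ.layerSubgroup n)) = x :=
    QuotientGroup.out_eq'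
  set F : (κ.twistModP ρ hM (p ^ n)).toTopRep ⟶ (κ.twistModP ρ hM (p ^ m)).toTopRep :=
    TopRep.ofHom ⟨(κ.twistModPShiftEmbed ρ hM (p ^ m)
        (Nat.pow_le_pow_right (Fact.out : p.Prime).pos hnm)).toContinuousLinearMap,
      (κ.twistModPShiftEmbed ρ hM (p ^ m)
        (Nat.pow_le_pow_right (Fact.out : p.Prime).pos hnm)).isIntertwining'⟩ with hF
  obtain ⟨φ, rfl⟩ := oneCocycleClass_surjective _ c
  change cores _ _ (κ.isOpen_layerSubgroup m)
      (cohomologyMap (κ.unitCoeffHom ρ hM m) 1 (resLe ρ.toTopRep _ 1 (oneCocycleClass _ φ))) =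
    cohomologyMap F 1 (cores _ _ (κ.isOpen_layerSubgroup n)
      (cohomologyMap (κ.unitCoeffHom ρ hM n) 1 (oneCocycleClass _ φ)))
  rw [← cores_coresLe_eq_cores _ (κ.layerSubgroup_antitone hnm) (κ.isOpen_layerSubgroup m)
      (κ.isOpen_layerSubgroup n),
    coresLe_cohomologyMap_resLe (κ.layerSubgroup_antitone hnm) (κ.isOpen_layerSubgroup m) hs
      (κ.unitCoeffHom ρ hM m),
    cohomologyMap_cores, cohomologyMap_oneCocycleClass, cohomologyMap_oneCocycleClass,
    cohomologyMap_oneCocycleClass]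
  refine congrArg _ (congrArg _ (Subtype.ext (ContinuousMap.ext fun u ↦ ?_)))
  rw [pullback_id_resIdHom_apply, pullback_id_resIdHom_apply, pullback_id_resIdHom_apply,
    normRepHom_hom_apply, subgroupRepHom_hom_apply, unitCoeffHom_hom_apply]
  exact κ.sum_normConj_unitCoeffHom ρ hM hnm hs (φ.1 u)

end Res

end ZpExtension

end Literature.NumberTheory.EllipticCurves

end
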